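import Mathlib

/-!
# Stub-ideation k = 2, GENERATION 13 (home family 2 = RESHAPE) for `stub_liftFive` of crux
# `FreyModularity` (stmt-ABC-11340, route ABC/DefiniteXi, line `Lines/Sketch.lean` sha 21576c53)

Companion of `STUB-IDEAS-stub_liftFive-2.md` (gen 13).  Mathlib-only on purpose (fast, immune to
Literature churn); the gen-12 companion `STUB_IDEAS_stub_liftFive_2g12.lean` (namespace
`…StubIdeas.LiftFive2g12`: `RTDatum`, `RTIsoExists`, `x5_of_rtIsoExists`, …) is the file these
helpers plug into — see §3 of the page for the eight-line splice.

* §A  **T-α — weaken OUT to what is consumed.**  `x5_of_rtIsoExists` (gen 12) uses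
  `Function.Bijective φ` only to build `θ := ψ ∘ φ⁻¹ : T → ℚ̄₅`.  A specialisation `ψ : R → ℚ̄₅`
  kills nilpotents and `5`-power torsion, so SURJECTIVE WITH NIL-OR-`5^∞`-TORSION KERNEL suffices —
  and that is the native output of Taylor–Wiles–Kisin patching (Kisin, Durham 2004 lectures,
  Cor. (1.4): "`R → T` surjective with `p`-power torsion kernel").  Lemmas `map_eq_zero_of_nil_or_tors`
  (XS, proved), `exists_lift_of_ker_le` (XS, proved = `RingHom.liftOfSurjective`),
  `outPrime` (the composite, proved); statements `FaithfulThroughInjective` (XS) and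
  `AnnQuotLeRadical` (S, SUPPORT-DESCENT: the step from the tree's PROVED
  `Literature.Barriers.Langlands.KisinSupportCriterion_holds` to the nil branch of `KerNilOrTors`).
* §B  **T-β — balance instead of induct.**  The tangent-space count showing that the STEINBERG
  local condition at a tame prime `q` with `ρ̄(Frob_q) ∼ diag(q e, e)` is balanced
  (`dim L_q = h⁰(G_q, ad⁰ρ̄) = 1`) exactly when `q² ≠ 1` in the residue field: two decidable-flavoured
  `2 × 2` matrix statements `H0Line`, `TameLine` (M each, `fin_cases`/`simp`), plus the honest
  exceptional count `TameLineExtra` at `q ≡ -1`.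
-/

namespace Summit.ABC.ABC.Cruxes.FreyModularity.StubIdeas.LiftFive2g13

/-! ## §A  T-α: OUT′ — surjective with nil/torsion kernel suffices -/

section OutPrime

variable {R T L : Type*} [CommRing R] [CommRing T] [Field L]

/-- The kernel condition patching outputs (`p`-power torsion), widened by nilpotents (harmless,
and what a non-reduced Hecke/deformation ring may contribute). -/
def KerNilOrTors (p : ℕ) (φ : R →+* T) : Prop :=
  ∀ x ∈ RingHom.ker φ, IsNilpotent x ∨ ∃ n : ℕ, (p : R) ^ n * x = 0

/-- XS-1 (PROVED): a nil-or-`p^∞`-torsion element dies under every ring map to a field of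
characteristic `≠ p` (here: `L = ℚ̄₅`, `p = 5`, `(5 : ℚ̄₅) ≠ 0`). -/
theorem map_eq_zero_of_nil_or_tors (p : ℕ) (hp : (p : L) ≠ 0) (ψ : R →+* L) {x : R}
    (hx : IsNilpotent x ∨ ∃ n : ℕ, (p : R) ^ n * x = 0) : ψ x = 0 := by
  rcases hx with hnil | ⟨n, hn⟩
  · exact (hnil.map ψ).eq_zero
  · have h := congrArg ψ hn
    rw [map_mul, map_pow, map_natCast, map_zero] at h
    exact (mul_eq_zero.mp h).resolve_left (pow_ne_zero n hp)

/-- XS-1′ (PROVED): hence `ker φ ≤ ker ψ`. -/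
theorem ker_le_ker_of_kerNilOrTors (p : ℕ) (hp : (p : L) ≠ 0) (φ : R →+* T) (ψ : R →+* L)
    (hφ : KerNilOrTors p φ) : RingHom.ker φ ≤ RingHom.ker ψ := fun x hx =>
  (RingHom.mem_ker).mpr (map_eq_zero_of_nil_or_tors p hp ψ (hφ x hx))

/-- XS-2 (PROVED, = `RingHom.liftOfSurjective`): factor through a surjection with smaller kernel. -/
theorem exists_lift_of_ker_le (φ : R →+* T) (ψ : R →+* L) (hs : Function.Surjective φ)
    (hk : RingHom.ker φ ≤ RingHom.ker ψ) : ∃ θ : T →+* L, θ.comp φ = ψ :=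
  ⟨φ.liftOfSurjective hs ⟨ψ, hk⟩, φ.liftOfSurjective_comp hs ⟨ψ, hk⟩⟩

/-- **OUT′ (PROVED): surjective + nil/`p^∞`-torsion kernel ⇒ every specialisation to a
characteristic-`≠ p` field factors through `T`.**  In `x5_of_rtIsoExists` (gen 12) this replaces
`AlgEquiv.ofBijective 𝓓.φ hbij`; the `O`-compatibility `θ (algebraMap O T x) = ι x` is then
`θ (φ (algebraMap O R x)) = ψ (algebraMap O R x) = ι x` by `AlgHom.commutes`. -/
theorem outPrime (p : ℕ) (hp : (p : L) ≠ 0) (φ : R →+* T) (ψ : R →+* L)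
    (hs : Function.Surjective φ) (hφ : KerNilOrTors p φ) :
    ∃ θ : T →+* L, ∀ r : R, θ (φ r) = ψ r := by
  obtain ⟨θ, hθ⟩ := exists_lift_of_ker_le φ ψ hs (ker_le_ker_of_kerNilOrTors p hp φ ψ hφ)
  exact ⟨θ, fun r => by rw [← RingHom.comp_apply, hθ]⟩

/-- FAITH→INJ (XS, statement): if a module on which `R` acts through `φ : R → T` is faithful over
`R`, then `φ` is injective — the last line of every patching argument ("`M_∞` faithful over `R_∞`
… hence `R ≅ T`"; tree, PROVED: `Literature.Barriers.Langlands.PatchingLocalComponentBarrier`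
`KisinSupportCriterion_holds` gives the faithfulness from `IsPatchingOutput` + `IsDomain`). -/
def FaithfulThroughInjective (φ : R →+* T) (M : Type*) [AddCommGroup M] [Module T M] : Prop :=
  (∀ r : R, (∀ m : M, φ r • m = 0) → r = 0) → Function.Injective φ

/-- SUPPORT-DESCENT (S, statement; Mathlib-only): a faithful finitely generated module stays
"faithful up to nilpotents" modulo any ideal — `Ann_R(M/IM) ⊆ √I` (determinant trick:
`r M ⊆ I M ⇒ rⁿ + a₁ rⁿ⁻¹ + … + aₙ ∈ Ann M = 0`, `aᵢ ∈ Iⁱ`; Mathlib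
`LinearMap.exists_monic_and_coeff_mem_pow_and_aeval_eq_zero_of_range_le_smul`).  This is the step
from the tree's PROVED `Literature.Barriers.Langlands.KisinSupportCriterion_holds`
(`IsPatchingOutput S_∞ R_∞ M_∞ → IsDomain R_∞ → Ann_{R_∞} M_∞ = ⊥`) to
"`ker (R_∞/𝔞 ↠ R ↠ T) ⊆ nil`", i.e. to the NIL branch of `KerNilOrTors`. [folklore; Kisin 2009 (3.3.4)] -/
def AnnQuotLeRadical : Prop :=
  ∀ (A M : Type) [CommRing A] [AddCommGroup M] [Module A M] [Module.Finite A M] (I : Ideal A),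
    Module.annihilator A M = ⊥ → Module.annihilator A (M ⧸ I • (⊤ : Submodule A M)) ≤ I.radical

end OutPrime

/-! ## §B  T-β: the balance count at a tame Steinberg prime (`2 × 2` linear algebra)

`k` = residue field (`𝔽₅` or `𝔽₂₅`), `q` = the image of the auxiliary prime, `e` = the unramified
eigenvalue: `ρ̄(Frob_q) ∼ F := diag(q e, e)` (eigenvalue ratio `q` = Ribet's level-raising
condition `tr² = (q+1)² det`, automatic when the lift `τ` is Steinberg at `q`).  `ad⁰ = sl₂(k)`.
* `H0Line`: `(sl₂)^{F} = k · diag(1,-1)` when `q ≠ 1`, `e ≠ 0` — so `h⁰(G_q, ad⁰ρ̄) = 1`.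
* `TameLine`: the inertia directions compatible with the tame relation `F N F⁻¹ = q N`, i.e.
  `{X ∈ M₂(k) : F X = q · X F}`, form the line `k · E₁₂` when moreover `q ≠ 0` and `q² ≠ 1` — this
  line IS the tangent space of the Steinberg condition, so `dim L_q^{St} = 1 = h⁰`: BALANCED, and
  unframed Taylor–Wiles patching at level `q ∥ N` costs no Ihara/congruence-ideal growth.
* `TameLineExtra`: at `q² = 1 ≠ q` (i.e. `q ≡ -1 (mod 5)`) the space is the PLANE
  `k E₁₂ ⊕ k E₂₁` — the honest exceptional regime (needs Kisin's framed `R_q^{St,□}`, Durham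
  Prop. (1.6), or the gen-12 Σ-induction at that prime). -/

section Balance

variable {k : Type*} [Field k]

/-- `F = diag(q e, e)`. -/
def frob (q e : k) : Matrix (Fin 2) (Fin 2) k := !![q * e, 0; 0, e]

/-- `H = diag(1, -1)`, `E₁₂`, `E₂₁`. -/
def hMat : Matrix (Fin 2) (Fin 2) k := !![1, 0; 0, -1]
def e12 : Matrix (Fin 2) (Fin 2) k := !![0, 1; 0, 0]
def e21 : Matrix (Fin 2) (Fin 2) k := !![0, 0; 1, 0]

/-- M-1 `H0Line`: the traceless matrices commuting with `F` are the multiples of `H`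
(`h⁰(G_q, ad⁰ρ̄) = 1` for non-scalar semisimple `ρ̄(Frob_q)`). -/
def H0Line : Prop :=
  ∀ (q e : k), q ≠ 1 → e ≠ 0 → ∀ X : Matrix (Fin 2) (Fin 2) k, X.trace = 0 →
    (frob q e * X = X * frob q e ↔ ∃ c : k, X = c • hMat)

/-- M-2 `TameLine`: for `q ∉ {0, 1, -1}` the solutions of `F X = q • (X F)` are the multiples of
`E₁₂` (they are automatically traceless): the Steinberg tangent LINE, `dim L_q^{St} = 1`. -/
def TameLine : Prop :=
  ∀ (q e : k), q ≠ 0 → q ≠ 1 → q ^ 2 ≠ 1 → e ≠ 0 → ∀ X : Matrix (Fin 2) (Fin 2) k,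
    (frob q e * X = q • (X * frob q e) ↔ ∃ c : k, X = c • e12)

/-- M-3 `TameLineExtra` (the exceptional count): for `q² = 1`, `q ≠ 1` (so `q = -1`, `char k ≠ 2`)
the solution space is the plane `k E₁₂ ⊕ k E₂₁` — unbalanced by one. -/
def TameLineExtra : Prop :=
  ∀ (q e : k), q ≠ 1 → q ^ 2 = 1 → e ≠ 0 → ∀ X : Matrix (Fin 2) (Fin 2) k,
    (frob q e * X = q • (X * frob q e) ↔ ∃ c d : k, X = c • e12 + d • e21)

/-- (PROVED) M-1. -/
theorem h0Line_holds : H0Line (k := k) := by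
  intro q e hq he X htr
  rw [Matrix.trace_fin_two] at htr
  constructor
  · intro h
    have h01 := congrArg (fun M => M 0 1) h
    have h10 := congrArg (fun M => M 1 0) h
    simp [frob, Matrix.mul_apply, Fin.sum_univ_two] at h01 h10
    have hb : X 0 1 = 0 := by
      have : ((q - 1) * e) * X 0 1 = 0 := by linear_combination h01
      rcases mul_eq_zero.mp this with h' | h'
      · exact absurd h' (mul_ne_zero (sub_ne_zero.mpr hq) he)
      · exact h'
    have hc : X 1 0 = 0 := by
      have : ((q - 1) * e) * X 1 0 = 0 := by linear_combination -h10
      rcases mul_eq_zero.mp this with h' | h'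
      · exact absurd h' (mul_ne_zero (sub_ne_zero.mpr hq) he)
      · exact h'
    refine ⟨X 0 0, ?_⟩
    ext i j
    fin_cases i <;> fin_cases j <;> simp [hMat, hb, hc]
    linear_combination htr
  · rintro ⟨c, rfl⟩
    ext i j
    fin_cases i <;> fin_cases j <;> simp [frob, hMat, Matrix.mul_apply, Fin.sum_univ_two] <;> ring

/-- (PROVED) M-2. -/
theorem tameLine_holds : TameLine (k := k) := by
  intro q e hq0 hq1 hq2 he X
  constructor
  · intro h
    have h00 := congrArg (fun M => M 0 0) h
    have h11 := congrArg (fun M => M 1 1) h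
    have h10 := congrArg (fun M => M 1 0) h
    simp [frob, Matrix.mul_apply, Fin.sum_univ_two] at h00 h11 h10
    have ha : X 0 0 = 0 := by
      have : ((q - 1) * (q * e)) * X 0 0 = 0 := by linear_combination -h00
      rcases mul_eq_zero.mp this with h' | h'
      · exact absurd h' (mul_ne_zero (sub_ne_zero.mpr hq1) (mul_ne_zero hq0 he))
      · exact h'
    have hd : X 1 1 = 0 := by
      have : ((q - 1) * e) * X 1 1 = 0 := by linear_combination -h11
      rcases mul_eq_zero.mp this with h' | h'
      · exact absurd h' (mul_ne_zero (sub_ne_zero.mpr hq1) he)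
      · exact h'
    have hc : X 1 0 = 0 := by
      have : ((q ^ 2 - 1) * e) * X 1 0 = 0 := by linear_combination -h10
      rcases mul_eq_zero.mp this with h' | h'
      · exact absurd h' (mul_ne_zero (sub_ne_zero.mpr hq2) he)
      · exact h'
    refine ⟨X 0 1, ?_⟩
    ext i j
    fin_cases i <;> fin_cases j <;> simp [e12, ha, hd, hc]
  · rintro ⟨c, rfl⟩
    ext i j
    fin_cases i <;> fin_cases j <;> simp [frob, e12, Matrix.mul_apply, Fin.sum_univ_two] <;> ring

/-- (PROVED) M-3. -/
theorem tameLineExtra_holds : TameLineExtra (k := k) := by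
  intro q e hq1 hq2 he X
  have hq0 : q ≠ 0 := by rintro rfl; simp at hq2
  constructor
  · intro h
    have h00 := congrArg (fun M => M 0 0) h
    have h11 := congrArg (fun M => M 1 1) h
    simp [frob, Matrix.mul_apply, Fin.sum_univ_two] at h00 h11
    have ha : X 0 0 = 0 := by
      have : ((q - 1) * (q * e)) * X 0 0 = 0 := by linear_combination -h00
      rcases mul_eq_zero.mp this with h' | h'
      · exact absurd h' (mul_ne_zero (sub_ne_zero.mpr hq1) (mul_ne_zero hq0 he))
      · exact h'
    have hd : X 1 1 = 0 := by
      have : ((q - 1) * e) * X 1 1 = 0 := by linear_combination -h11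
      rcases mul_eq_zero.mp this with h' | h'
      · exact absurd h' (mul_ne_zero (sub_ne_zero.mpr hq1) he)
      · exact h'
    refine ⟨X 0 1, X 1 0, ?_⟩
    ext i j
    fin_cases i <;> fin_cases j <;> simp [e12, e21, ha, hd]
  · rintro ⟨c, d, rfl⟩
    ext i j
    fin_cases i <;> fin_cases j <;>
      simp [frob, e12, e21, Matrix.mul_apply, Fin.sum_univ_two] <;>
      first | ring1 | linear_combination (-(d * e)) * hq2

/-- Sanity instance of the regime split at `ℓ = 5`: in `𝔽₅` the balanced residues (`q² ≠ 1`,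
`q ≠ 0`) are exactly `q ≡ 2, 3 (mod 5)`. -/
example : ∀ q : ZMod 5, (q ≠ 0 ∧ q ^ 2 ≠ 1) ↔ (q = 2 ∨ q = 3) := by decide

end Balance

end Summit.ABC.ABC.Cruxes.FreyModularity.StubIdeas.LiftFive2g13
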